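import Mathlib.Analysis.Calculus.MeanValue
import Literature.Analysis.FunctionSpaces.ContDiffHolderLeibniz
import Literature.Analysis.FunctionSpaces.ContDiffHolderOne
import HarnessLib

/-!
# Interpolation inequalities for the `C^{k,α}` norms at scale `ε`

Analysis/FunctionSpaces support file (everything proved; no definitions). Buckmaster–De Lellis–
Székelyhidi–Vicol 2019, App. A, record as "elementary inequalities" the Hölder interpolation
inequalities

  (A.1) `[f]_s ≤ C (ε^{r-s} [f]_r + ε^{-s} ‖f‖₀)`  (`r ≥ s ≥ 0`, `ε > 0`),
  (A.3) `[f]_s ≤ C ‖f‖₀^{1-s/r} [f]_r^{s/r}`,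

together with the product rule (A.2) `[fg]_r ≤ C([f]_r‖g‖₀ + ‖f‖₀[g]_r)` (Gilbarg–Trudinger 2001,
§6.8, Lemma 6.35 is the version on domains). For the accepted total norms of the tree,
`eContDiffHolderNorm k r f = ∑_{j ≤ k} ‖Dʲf‖_∞ + [Dᵏf]_r` on a real normed space and
`Torus.eContDiffHolderNorm k r` on the flat torus (`HolderNorm.lean`), this file proves (A.1) in
the whole-space setting, where no geometry of the domain enters, and the consequence of
(A.1)/(A.3) that the stationary phase and transport estimates of BDSV §§5–6 actually consume:
the **tame product inequality** `‖f‖_{j₁,r₁} ‖g‖_{j₂,r₂} ≲ ‖f‖_∞ ‖g‖_{k,r} + ‖f‖_{k,r} ‖g‖_∞` for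
`(j₁ + r₁) + (j₂ + r₂) ≤ k + r`.

## Main statements

* `eHolderNorm_le_of_eHolderNorm_of_edist_le`: two Hölder exponents at scale `δ`,
  `[g]_{r'} ≤ [g]_r δ^{r-r'} + osc(g) δ^{-r'}` for `r' ≤ r`;
* `norm_fderiv_le_landau_of_holderWith`, `eSupNorm_fderiv_le_landau_eHolderNorm`: **Landau's
  inequality with a Hölder modulus**
  `‖Df‖_∞ ≤ (2/h)‖f‖_∞ + h^r [Df]_r` for every `h > 0` (Taylor's formula with the mean value
  inequality applied to `y ↦ f y - Df(x) y` on the ball `B(x, h)`);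
* `sum_eSupNorm_iteratedFDeriv_le`: for `f ∈ C^k` with `‖f‖_{C^{k,r}} < ∞` and `ε > 0`,
  `∑_{j ≤ k} εʲ ‖Dʲf‖_∞ ≤ 9^{2^k-1} (‖f‖_∞ + ε^{k+r}[Dᵏf]_r)` — by induction on `k` through `Df`
  (`∑_{j≤k+1} εʲ‖Dʲf‖_∞ = ‖f‖_∞ + ε ∑_{j≤k} εʲ‖Dʲ(Df)‖_∞`), the first-order term being absorbed by
  Landau's inequality at scale `tε` with `t = 1/(2·9^{2^k-1})` (this absorption is where the
  finiteness `‖f‖_{C^{k,r}} < ∞` is used);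
* `eContDiffHolderNorm_le_interp_of_le_one`: **(A.1) for the full norms**,
  `‖f‖_{C^{j,r'}} ≤ 5·9^{2^k-1} ε^{-(j+r')} (‖f‖_∞ + ε^{k+r}[Dᵏf]_r)` for `0 < ε ≤ 1` and every
  intermediate order (`j < k` and `r' ≤ 1`, or `j = k` and `r' ≤ r`);
* on the torus, for smooth `f` (all norms finite, `Torus.IsSmooth.eContDiffHolderNorm_lt_top`):
  `Torus.eContDiffHolderNorm_le_interp_of_le_one`, the comparison
  `Torus.eContDiffHolderNorm_le_eSupNorm_add` (`ε = 1`), and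
  `Torus.eContDiffHolderNorm_mul_le_mixed_tame`:
  `‖f‖_{j₁,r₁}‖g‖_{j₂,r₂} ≤ 2(5·9^{2^k-1})² (‖f‖_∞‖g‖_{k,r} + ‖f‖_{k,r}‖g‖_∞)` — both factors are
  interpolated at the common scale `ε = (‖f‖_∞/‖f‖_{k,r})^{1/(k+r)} ≤ 1`, for which
  `ε^{k+r}‖f‖_{k,r} = ‖f‖_∞` and `ε^{-(j₁+r₁+j₂+r₂)}‖f‖_∞ ≤ ‖f‖_{k,r}` (this is (A.3) in disguise,
  with no real powers of norms in the statement).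

Constants are explicit but not optimised. What is NOT here: interpolation on domains
(Gilbarg–Trudinger Lemma 6.35 proper). Three sibling files treat the interpolation at a FIXED
Hölder exponent `r` across integer orders — `ContDiffHolderLogConvex.lean`
(`‖f‖²_{m+1,r} ≤ 51‖f‖_{m,r}‖f‖_{m+2,r}`), `HolderInterpolationTorus.lean` (products
`‖f‖_{p,r}‖f‖_{q,r} ≲ ‖f‖_{k,r}‖f‖_{m,r}` of ONE function) and `HolderInterpolationLandau.lean`
(three-level inequality `‖f‖_{k,r} ≲ ‖f‖_{k₀,r}^{1-θ}‖f‖_{k₁,r}^θ`); none of them reaches the sup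
norm `‖f‖_∞` as the lower endpoint or mixes the exponents (`‖f‖_{j,0}` against `‖f‖_{k,α}`),
which is the form in which (A.1)/(A.3) enter the stationary phase lemma (BDSV Prop. C.2:
`‖a‖₀` against `‖a‖_{N+α}`) and which is proved here, for two different functions.

## Mathlib / tree search

Mathlib: `Convex.norm_image_sub_le_of_norm_fderiv_le`, `lipschitzWith_of_nnnorm_fderiv_le`,
`norm_iteratedFDeriv_fderiv`, `norm_fderiv_iteratedFDeriv`, `iteratedFDeriv_succ_eq_comp_right`,
`HolderWith.dist_le_of_le`, `Real.rpow_*`; no interpolation inequality for Hölder or `C^k` norms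
(`lean search 'interpol.*Holder|Landau.*inequality|Kolmogorov'`). Tree: `HolderInterpolation`
(`holderWith_of_lipschitzWith_of_edist_le`, the Lipschitz case of the two-exponent lemma, in
`ℝ≥0` form), `ContDiffHolderAlgebra`, `ContDiffHolderLeibniz` (`eContDiffHolderNorm_succ_eq_fderiv`,
`eHolderNorm_congr_edist`), `ContDiffHolderOne`, `TorusHolderBridge` (`eSupNorm_lift`),
`ContDiffHolderLogConvex` (second differences; independent).

## References

* T. Buckmaster, C. De Lellis, L. Székelyhidi Jr., V. Vicol, *Onsager's conjecture for admissible
  weak solutions*, CPAM 72 (2019) = arXiv:1701.08678, App. A, (A.1)–(A.3). [`BuckmasterEtAl2018`]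
* D. Gilbarg, N. S. Trudinger, *Elliptic Partial Differential Equations of Second Order* (2001),
  §6.8, Lemma 6.35; (6.82)–(6.86). [`GilbargTrudinger2001`]
-/

open Set Filter
open scoped NNReal ENNReal ContDiff Topology

noncomputable section

universe u

namespace Literature.Analysis.FunctionSpaces

section TwoExponents

variable {X Y : Type*} [MetricSpace X] [EMetricSpace Y]

/-- **Interpolation between two Hölder exponents at scale `δ`.** If `g` is `r`-Hölder with
(extended) constant `[g]_r` and has oscillation at most `B`, then for `r' ≤ r` and every scale
`δ > 0`, `[g]_{r'} ≤ [g]_r δ^{r-r'} + B δ^{-r'}`: increments over distances `≤ δ` are bounded by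
`[g]_r d^r ≤ [g]_r δ^{r-r'} d^{r'}`, the others by `B ≤ B δ^{-r'} d^{r'}` (Gilbarg–Trudinger 2001,
(6.8)–(6.9); BDSV App. A (A.1)). [folklore] -/
theorem eHolderNorm_le_of_eHolderNorm_of_edist_le {g : X → Y} {B : ℝ≥0∞}
    (hB : ∀ x y, edist (g x) (g y) ≤ B) {r r' : ℝ≥0} (hr : r' ≤ r) {δ : ℝ≥0} (hδ : 0 < δ) :
    eHolderNorm r' g ≤
      eHolderNorm r g * (δ : ℝ≥0∞) ^ ((r : ℝ) - r') + B * (δ : ℝ≥0∞)⁻¹ ^ (r' : ℝ) := by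
  refine eHolderNorm_le_of_forall_edist_le fun x y => ?_
  have hr0 : (0 : ℝ) ≤ r' := r'.2
  have hrr : (0 : ℝ) ≤ r - r' := by
    have : (r' : ℝ) ≤ r := by exact_mod_cast hr
    linarith
  have hδ0 : (δ : ℝ≥0∞) ≠ 0 := by exact_mod_cast hδ.ne'
  have hδt : (δ : ℝ≥0∞) ≠ ⊤ := ENNReal.coe_ne_top
  set e := edist x y with he
  rcases le_or_gt e δ with hle | hgt
  · -- small increments: the `r`-Hölder bound
    calc edist (g x) (g y) ≤ eHolderNorm r g * e ^ (r : ℝ) := edist_le_eHolderNorm_mul_rpow r g x y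
      _ = eHolderNorm r g * (e ^ ((r : ℝ) - r') * e ^ (r' : ℝ)) := by
          rw [← ENNReal.rpow_add_of_nonneg _ _ hrr hr0, sub_add_cancel]
      _ ≤ eHolderNorm r g * ((δ : ℝ≥0∞) ^ ((r : ℝ) - r') * e ^ (r' : ℝ)) := by
          gcongr
      _ ≤ (eHolderNorm r g * (δ : ℝ≥0∞) ^ ((r : ℝ) - r') + B * (δ : ℝ≥0∞)⁻¹ ^ (r' : ℝ)) *
            e ^ (r' : ℝ) := by
          rw [← mul_assoc]
          gcongr
          exact le_self_add
  · -- large increments: the oscillation bound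
    have hone : (δ : ℝ≥0∞)⁻¹ ^ (r' : ℝ) * (δ : ℝ≥0∞) ^ (r' : ℝ) = 1 := by
      rw [← ENNReal.mul_rpow_of_nonneg _ _ hr0, ENNReal.inv_mul_cancel hδ0 hδt, ENNReal.one_rpow]
    calc edist (g x) (g y) ≤ B := hB x y
      _ = B * ((δ : ℝ≥0∞)⁻¹ ^ (r' : ℝ) * (δ : ℝ≥0∞) ^ (r' : ℝ)) := by rw [hone, mul_one]
      _ ≤ B * ((δ : ℝ≥0∞)⁻¹ ^ (r' : ℝ) * e ^ (r' : ℝ)) := by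
          gcongr
      _ = B * (δ : ℝ≥0∞)⁻¹ ^ (r' : ℝ) * e ^ (r' : ℝ) := by ring
      _ ≤ (eHolderNorm r g * (δ : ℝ≥0∞) ^ ((r : ℝ) - r') + B * (δ : ℝ≥0∞)⁻¹ ^ (r' : ℝ)) *
            e ^ (r' : ℝ) := by
          gcongr
          exact le_add_self

end TwoExponents


section Landau

variable {E' Y : Type*} [NormedAddCommGroup E'] [NormedSpace ℝ E'] [NormedAddCommGroup Y]
  [NormedSpace ℝ Y]

/-- Pointwise **Landau inequality with a Hölder modulus**: if `f` is differentiable, `‖f‖ ≤ M`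
everywhere and `Df` is `r`-Hölder with constant `H`, then `‖Df(x)‖ ≤ 2M/h + H hʳ` for every
`h > 0` (the mean value inequality applied to `y ↦ f y - Df(x) y` on the ball `B(x, h)` gives
`‖f(x+u) - f(x) - Df(x)u‖ ≤ H hʳ ‖u‖` for `‖u‖ = h`; Gilbarg–Trudinger (6.8)–(6.9), BDSV (A.1)
for `s = 1`). The `C²` version with `‖D²f‖_∞` is `norm_fderiv_le_landau` of
`HolderInterpolationLandau.lean`. [folklore] -/
theorem norm_fderiv_le_landau_of_holderWith {f : E' → Y} (hf : Differentiable ℝ f) {M : ℝ}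
    (hM : ∀ x, ‖f x‖ ≤ M)
    {H r : ℝ≥0} (hH : HolderWith H r (fderiv ℝ f)) {h : ℝ} (hh : 0 < h) (x : E') :
    ‖fderiv ℝ f x‖ ≤ 2 * M / h + H * h ^ (r : ℝ) := by
  have hM0 : 0 ≤ M := (norm_nonneg _).trans (hM x)
  have hK0 : 0 ≤ 2 * M / h + H * h ^ (r : ℝ) := by positivity
  have hmain : ∀ u : E', ‖u‖ = h → ‖fderiv ℝ f x u‖ ≤ 2 * M + H * h ^ (r : ℝ) * h := by
    intro u hu
    set g : E' → Y := fun y => f y - fderiv ℝ f x y with hg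
    have hgd : ∀ y ∈ Metric.closedBall x h, DifferentiableAt ℝ g y := fun y _ =>
      (hf y).sub ((fderiv ℝ f x).differentiableAt)
    have hgb : ∀ y ∈ Metric.closedBall x h, ‖fderiv ℝ g y‖ ≤ H * h ^ (r : ℝ) := by
      intro y hy
      have hDg : fderiv ℝ g y = fderiv ℝ f y - fderiv ℝ f x := by
        rw [hg, fderiv_fun_sub (hf y) (fderiv ℝ f x).differentiableAt, ContinuousLinearMap.fderiv]
      rw [hDg, ← dist_eq_norm]
      exact hH.dist_le_of_le (Metric.mem_closedBall.1 hy)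
    have hxs : x ∈ Metric.closedBall x h := Metric.mem_closedBall_self hh.le
    have hus : x + u ∈ Metric.closedBall x h := by
      rw [Metric.mem_closedBall, dist_eq_norm, add_sub_cancel_left, hu]
    have hmv := (convex_closedBall x h).norm_image_sub_le_of_norm_fderiv_le hgd hgb hxs hus
    have hid : g (x + u) - g x = f (x + u) - f x - fderiv ℝ f x u := by
      simp only [hg, map_add]
      abel
    rw [hid, add_sub_cancel_left, hu] at hmv
    calc ‖fderiv ℝ f x u‖ = ‖(f (x + u) - f x) - (f (x + u) - f x - fderiv ℝ f x u)‖ := by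
          congr 1; abel
      _ ≤ ‖f (x + u) - f x‖ + ‖f (x + u) - f x - fderiv ℝ f x u‖ := norm_sub_le _ _
      _ ≤ (‖f (x + u)‖ + ‖f x‖) + H * h ^ (r : ℝ) * h := add_le_add (norm_sub_le _ _) hmv
      _ ≤ (M + M) + H * h ^ (r : ℝ) * h := by gcongr <;> exact hM _
      _ = 2 * M + H * h ^ (r : ℝ) * h := by ring
  refine ContinuousLinearMap.opNorm_le_bound _ hK0 fun v => ?_
  rcases eq_or_ne v 0 with rfl | hv
  · simp
  have hv0 : 0 < ‖v‖ := norm_pos_iff.2 hv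
  set u : E' := (h / ‖v‖) • v with hu
  have hun : ‖u‖ = h := by
    rw [hu, norm_smul, Real.norm_of_nonneg (by positivity), div_mul_cancel₀ _ hv0.ne']
  have hvu : v = (‖v‖ / h) • u := by
    rw [hu, smul_smul, div_mul_div_cancel₀ hh.ne', div_self hv0.ne', one_smul]
  have h1 := hmain u hun
  calc ‖fderiv ℝ f x v‖ = ‖v‖ / h * ‖fderiv ℝ f x u‖ := by
        conv_lhs => rw [hvu]
        rw [map_smul, norm_smul, Real.norm_of_nonneg (by positivity)]
    _ ≤ ‖v‖ / h * (2 * M + H * h ^ (r : ℝ) * h) := by gcongr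
    _ = (2 * M / h + H * h ^ (r : ℝ)) * ‖v‖ := by
        field_simp

/-- **Landau's inequality** for the extended sup norm of the derivative at scale `h > 0`:
`‖Df‖_∞ ≤ (2/h) ‖f‖_∞ + hʳ [Df]_r` for a differentiable `f` (all quantities extended; the cases
`‖f‖_∞ = ∞` or `[Df]_r = ∞` are trivial). [folklore] -/
theorem eSupNorm_fderiv_le_landau_eHolderNorm {f : E' → Y} (hf : Differentiable ℝ f) (r : ℝ≥0)
    {h : ℝ} (hh : 0 < h) :
    eSupNorm (fderiv ℝ f) ≤
      ENNReal.ofReal (2 / h) * eSupNorm f + ENNReal.ofReal (h ^ (r : ℝ)) * eHolderNorm r (fderiv ℝ f) := by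
  by_cases hM : eSupNorm f = ⊤
  · have h2 : ENNReal.ofReal (2 / h) ≠ 0 := by
      rw [Ne, ENNReal.ofReal_eq_zero, not_le]; positivity
    rw [hM, ENNReal.mul_top h2, top_add]
    exact le_top
  by_cases hHt : eHolderNorm r (fderiv ℝ f) = ⊤
  · have h2 : ENNReal.ofReal (h ^ (r : ℝ)) ≠ 0 := by
      rw [Ne, ENNReal.ofReal_eq_zero, not_le]; positivity
    rw [hHt, ENNReal.mul_top h2, add_top]
    exact le_top
  have hmem : MemHolder r (fderiv ℝ f) := eHolderNorm_ne_top.1 hHt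
  have hH : HolderWith (nnHolderNorm r (fderiv ℝ f)) r (fderiv ℝ f) := hmem.holderWith
  have hMx : ∀ x, ‖f x‖ ≤ (eSupNorm f).toReal := fun x => by
    rw [← ENNReal.ofReal_le_iff_le_toReal hM, ofReal_norm]
    exact enorm_le_eSupNorm f x
  refine iSup_le fun x => ?_
  have hx := norm_fderiv_le_landau_of_holderWith hf hMx hH hh x
  have hM0 : 0 ≤ (eSupNorm f).toReal := ENNReal.toReal_nonneg
  calc ‖fderiv ℝ f x‖ₑ = ENNReal.ofReal ‖fderiv ℝ f x‖ := (ofReal_norm _).symm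
    _ ≤ ENNReal.ofReal (2 * (eSupNorm f).toReal / h + nnHolderNorm r (fderiv ℝ f) * h ^ (r : ℝ)) :=
        ENNReal.ofReal_le_ofReal hx
    _ = ENNReal.ofReal (2 / h) * eSupNorm f +
          ENNReal.ofReal (h ^ (r : ℝ)) * eHolderNorm r (fderiv ℝ f) := by
        rw [ENNReal.ofReal_add (by positivity) (by positivity),
          show 2 * (eSupNorm f).toReal / h = 2 / h * (eSupNorm f).toReal by ring,
          ENNReal.ofReal_mul (by positivity), ENNReal.ofReal_toReal hM, mul_comm (nnHolderNorm r _ : ℝ),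
          ENNReal.ofReal_mul (by positivity), ENNReal.ofReal_coe_nnreal,
          hmem.coe_nnHolderNorm_eq_eHolderNorm]

end Landau

section Shift

variable {E' Y : Type*} [NormedAddCommGroup E'] [NormedSpace ℝ E'] [NormedAddCommGroup Y]
  [NormedSpace ℝ Y]

/-- `‖Dʲ⁺¹f‖_∞ = ‖Dʲ(Df)‖_∞` (Mathlib `norm_iteratedFDeriv_fderiv`). [folklore] -/
theorem eSupNorm_iteratedFDeriv_succ_eq_fderiv (j : ℕ) (f : E' → Y) :
    eSupNorm (iteratedFDeriv ℝ (j + 1) f) = eSupNorm (iteratedFDeriv ℝ j (fderiv ℝ f)) := by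
  simp only [eSupNorm, ← ofReal_norm, norm_iteratedFDeriv_fderiv]

/-- `[Dᵏ⁺¹f]_r = [Dᵏ(Df)]_r` (the two differ by a linear isometry,
`iteratedFDeriv_succ_eq_comp_right`). [folklore] -/
theorem eHolderNorm_iteratedFDeriv_succ_eq_fderiv (k : ℕ) (r : ℝ≥0) (f : E' → Y) :
    eHolderNorm r (iteratedFDeriv ℝ (k + 1) f) = eHolderNorm r (iteratedFDeriv ℝ k (fderiv ℝ f)) := by
  refine eHolderNorm_congr_edist r fun x y => ?_
  rw [iteratedFDeriv_succ_eq_comp_right, iteratedFDeriv_succ_eq_comp_right]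
  exact (LinearIsometryEquiv.isometry _).edist_eq _ _

/-- The shift of the weighted sums: `∑_{j ≤ k+1} εʲ ‖Dʲf‖_∞ = ‖f‖_∞ + ε ∑_{j ≤ k} εʲ ‖Dʲ(Df)‖_∞`
(`ε ≥ 0`). [folklore] -/
theorem sum_eSupNorm_iteratedFDeriv_succ {ε : ℝ} (hε : 0 ≤ ε) (k : ℕ) (f : E' → Y) :
    ∑ j ∈ Finset.range (k + 1 + 1), ENNReal.ofReal (ε ^ j) * eSupNorm (iteratedFDeriv ℝ j f) =
      eSupNorm f + ENNReal.ofReal ε *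
        ∑ j ∈ Finset.range (k + 1), ENNReal.ofReal (ε ^ j) * eSupNorm (iteratedFDeriv ℝ j (fderiv ℝ f)) := by
  rw [Finset.sum_range_succ' _ (k + 1), pow_zero, ENNReal.ofReal_one, one_mul,
    eSupNorm_iteratedFDeriv_zero, add_comm, Finset.mul_sum]
  congr 1
  refine Finset.sum_congr rfl fun j _ => ?_
  rw [eSupNorm_iteratedFDeriv_succ_eq_fderiv, pow_succ, ENNReal.ofReal_mul (pow_nonneg hε j)]
  ring

/-- `Df` is Lipschitz with constant `‖D²f‖_∞` for a `C²` map: `[Df]_1 ≤ ‖D²f‖_∞`. [folklore] -/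
theorem eHolderNorm_one_fderiv_le (f : E' → Y) (hf : ContDiff ℝ 2 f) :
    eHolderNorm 1 (fderiv ℝ f) ≤ eSupNorm (iteratedFDeriv ℝ 2 f) := by
  by_cases hT : eSupNorm (iteratedFDeriv ℝ 2 f) = ⊤
  · rw [hT]; exact le_top
  have hd : Differentiable ℝ (fderiv ℝ f) :=
    (hf.fderiv_right (m := 1) (by norm_num)).differentiable (by simp)
  have hLip : LipschitzWith (eSupNorm (iteratedFDeriv ℝ 2 f)).toNNReal (fderiv ℝ f) := by
    refine lipschitzWith_of_nnnorm_fderiv_le hd fun x => ?_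
    rw [← ENNReal.coe_le_coe, ENNReal.coe_toNNReal hT, ← enorm_eq_nnnorm, ← ofReal_norm,
      ← norm_iteratedFDeriv_one, norm_iteratedFDeriv_fderiv, ofReal_norm]
    exact enorm_le_eSupNorm _ x
  refine (hLip.holderWith.eHolderNorm_le).trans ?_
  rw [ENNReal.coe_toNNReal hT]

/-- `‖Dʲf‖_∞ ≤ ‖f‖_{C^{k,r}}` for `j ≤ k`. [folklore] -/
theorem eSupNorm_iteratedFDeriv_le_eContDiffHolderNorm_of_le {j k : ℕ} (hj : j ≤ k) (r : ℝ≥0)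
    (f : E' → Y) :
    eSupNorm (iteratedFDeriv ℝ j f) ≤ eContDiffHolderNorm k r f :=
  iSup_le fun x => enorm_iteratedFDeriv_le_eContDiffHolderNorm hj r f x

/-- Absorbing a half: `a ≤ b + a/2` with `a` finite gives `a ≤ 2b`. [folklore] -/
theorem ennreal_le_two_mul_of_le_add_half {a b : ℝ≥0∞} (ha : a ≠ ⊤) (h : a ≤ b + 2⁻¹ * a) :
    a ≤ 2 * b := by
  have h2 : 2⁻¹ * a = a / 2 := by rw [div_eq_mul_inv, mul_comm]
  rw [h2] at h
  have h3 : a / 2 ≤ b := by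
    have := tsub_le_iff_right.2 h
    rwa [ENNReal.sub_half ha] at this
  calc a = 2 * (a / 2) := (ENNReal.mul_div_cancel (by norm_num) (by norm_num)).symm
    _ ≤ 2 * b := by gcongr

end Shift


section WeightedSum

variable {E' : Type u} [NormedAddCommGroup E'] [NormedSpace ℝ E']

/-- **Interpolation of the intermediate derivatives (sup norms), weighted form.** For a `C^k` map
`f` on a real normed space with `‖f‖_{C^{k,r}} < ∞` and every scale `ε > 0`,
`∑_{j ≤ k} εʲ ‖Dʲf‖_∞ ≤ 9^{2^k - 1} (‖f‖_∞ + ε^{k+r} [Dᵏf]_r)`. This is the whole-space form of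
the interpolation inequality Gilbarg–Trudinger 2001, Lemma 6.35 / BDSV App. A (A.1),
`[f]_s ≤ C(ε^{r-s}[f]_r + ε^{-s}‖f‖₀)` for the integer orders `s ≤ k`; proof by induction on `k`
through `Df` (`∑_{j≤k+1} εʲ‖Dʲf‖_∞ = ‖f‖_∞ + ε ∑_{j≤k} εʲ‖Dʲ(Df)‖_∞`), the first-order term being
absorbed by Landau's inequality `ε‖Df‖_∞ ≤ (2/t)‖f‖_∞ + t ε²‖D²f‖_∞` with `t` small. [folklore] -/
theorem sum_eSupNorm_iteratedFDeriv_le (k : ℕ) {Y : Type u} [NormedAddCommGroup Y] [NormedSpace ℝ Y]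
    {f : E' → Y} (hf : ContDiff ℝ k f) {r : ℝ≥0} (hfin : eContDiffHolderNorm k r f ≠ ⊤) {ε : ℝ}
    (hε : 0 < ε) :
    ∑ j ∈ Finset.range (k + 1), ENNReal.ofReal (ε ^ j) * eSupNorm (iteratedFDeriv ℝ j f) ≤
      9 ^ (2 ^ k - 1) *
        (eSupNorm f + ENNReal.ofReal (ε ^ ((k : ℝ) + r)) * eHolderNorm r (iteratedFDeriv ℝ k f)) := by
  induction k generalizing Y with
  | zero =>
    simp only [zero_add, Finset.range_one, Finset.sum_singleton, pow_zero, ENNReal.ofReal_one,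
      one_mul, eSupNorm_iteratedFDeriv_zero, Nat.sub_self, CharP.cast_eq_zero]
    exact le_self_add
  | succ k IH =>
    cases k with
    | zero =>
      -- `k = 1`: Landau's inequality with the Hölder modulus, at scale `ε`
      have hd : Differentiable ℝ f := hf.differentiable (by simp)
      have hL := eSupNorm_fderiv_le_landau_eHolderNorm hd r hε
      -- normalise `0 + 1` to `1`
      suffices hgoal : ∑ j ∈ Finset.range (1 + 1), ENNReal.ofReal (ε ^ j) * eSupNorm (iteratedFDeriv ℝ j f) ≤
          9 * (eSupNorm f + ENNReal.ofReal (ε ^ ((1 : ℝ) + r)) * eHolderNorm r (iteratedFDeriv ℝ 1 f)) by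
        refine le_of_le_of_eq (le_of_eq_of_le rfl hgoal) ?_
        norm_num
      rw [eHolderNorm_iteratedFDeriv_one, sum_eSupNorm_iteratedFDeriv_succ hε.le 0 f]
      simp only [Finset.sum_range_succ, Finset.sum_range_zero, zero_add, pow_zero, ENNReal.ofReal_one,
        one_mul, eSupNorm_iteratedFDeriv_zero]
      have hε2 : ENNReal.ofReal ε * ENNReal.ofReal (2 / ε) = 2 := by
        rw [← ENNReal.ofReal_mul hε.le, mul_div_cancel₀ _ hε.ne', ENNReal.ofReal_ofNat]
      have hεr : ENNReal.ofReal ε * ENNReal.ofReal (ε ^ (r : ℝ)) = ENNReal.ofReal (ε ^ ((1 : ℝ) + r)) := by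
        rw [← ENNReal.ofReal_mul hε.le, Real.rpow_add hε, Real.rpow_one]
      calc eSupNorm f + ENNReal.ofReal ε * eSupNorm (fderiv ℝ f)
          ≤ eSupNorm f + ENNReal.ofReal ε * (ENNReal.ofReal (2 / ε) * eSupNorm f +
              ENNReal.ofReal (ε ^ (r : ℝ)) * eHolderNorm r (fderiv ℝ f)) := by gcongr
        _ = 3 * eSupNorm f + ENNReal.ofReal (ε ^ ((1 : ℝ) + r)) * eHolderNorm r (fderiv ℝ f) := by
            rw [mul_add, ← mul_assoc, ← mul_assoc, hε2, hεr]; ring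
        _ ≤ 9 * eSupNorm f + 9 * (ENNReal.ofReal (ε ^ ((1 : ℝ) + r)) * eHolderNorm r (fderiv ℝ f)) :=
            add_le_add (mul_le_mul' (by norm_num) le_rfl) (le_mul_of_one_le_left' (by norm_num))
        _ = 9 * (eSupNorm f + ENNReal.ofReal (ε ^ ((1 : ℝ) + r)) * eHolderNorm r (fderiv ℝ f)) := by
            rw [mul_add]
    | succ k =>
      -- `k + 2` from `k + 1` applied to `Df`
      set B : ℝ≥0∞ := 9 ^ (2 ^ (k + 1) - 1) with hB
      have hB1 : 1 ≤ B := one_le_pow_of_one_le' (by norm_num) _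
      have hB0 : B ≠ 0 := (zero_lt_one.trans_le hB1).ne'
      have hBt : B ≠ ⊤ := ENNReal.pow_ne_top (by norm_num)
      have hf1 : ContDiff ℝ (k + 1 : ℕ) (fderiv ℝ f) := hf.fderiv_right (by norm_cast)
      have hf2 : ContDiff ℝ 2 f := hf.of_le (by norm_cast; omega)
      have hd : Differentiable ℝ f := hf.differentiable (by simp)
      -- finiteness
      have hshift : eContDiffHolderNorm (k + 1 + 1) r f =
          eSupNorm f + eContDiffHolderNorm (k + 1) r (fderiv ℝ f) := eContDiffHolderNorm_succ_eq_fderiv _ r f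
      have hfin1 : eContDiffHolderNorm (k + 1) r (fderiv ℝ f) ≠ ⊤ :=
        ne_top_of_le_ne_top hfin (hshift ▸ le_add_self)
      have hM₁fin : eSupNorm (fderiv ℝ f) ≠ ⊤ := by
        refine ne_top_of_le_ne_top hfin ?_
        rw [← eSupNorm_iteratedFDeriv_one]
        exact eSupNorm_iteratedFDeriv_le_eContDiffHolderNorm_of_le (by omega) r f
      -- the induction hypothesis for `Df`
      have hIH := IH hf1 hfin1
      rw [← eHolderNorm_iteratedFDeriv_succ_eq_fderiv] at hIH
      set S : ℝ≥0∞ := ∑ j ∈ Finset.range (k + 1 + 1),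
        ENNReal.ofReal (ε ^ j) * eSupNorm (iteratedFDeriv ℝ j (fderiv ℝ f)) with hS
      set H : ℝ≥0∞ := eHolderNorm r (iteratedFDeriv ℝ (k + 1 + 1) f) with hH
      set M₀ : ℝ≥0∞ := eSupNorm f with hM₀
      set M₁ : ℝ≥0∞ := eSupNorm (fderiv ℝ f) with hM₁
      set M₂ : ℝ≥0∞ := eSupNorm (iteratedFDeriv ℝ 2 f) with hM₂
      set P : ℝ≥0∞ := ENNReal.ofReal (ε ^ ((↑(k + 1) : ℝ) + r)) with hP
      -- `M₁` and `ε M₂` are dominated by `S`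
      have hM₂S : ENNReal.ofReal ε * M₂ ≤ S := by
        rw [hS, Finset.sum_range_succ' _ (k + 1), Finset.sum_range_succ' _ k, pow_one,
          ← eSupNorm_iteratedFDeriv_succ_eq_fderiv 1 f]
        exact le_trans le_add_self le_self_add
      -- the powers of `ε`
      have hεpow : ENNReal.ofReal (ε ^ ((↑(k + 1 + 1) : ℝ) + r)) = ENNReal.ofReal ε * P := by
        rw [hP, ← ENNReal.ofReal_mul hε.le]
        congr 1
        rw [show ((↑(k + 1 + 1) : ℝ) + r) = 1 + (((↑(k + 1) : ℝ)) + r) by push_cast; ring,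
          Real.rpow_add hε, Real.rpow_one]
      -- Landau with exponent `1` at scale `t ε`, `t = 1/(2B)`
      set t : ℝ := (2 * B.toReal)⁻¹ with ht
      have hBpos : 0 < B.toReal := ENNReal.toReal_pos hB0 hBt
      have htpos : 0 < t := by rw [ht]; positivity
      have hL := eSupNorm_fderiv_le_landau_eHolderNorm hd 1 (mul_pos htpos hε)
      have hLip := eHolderNorm_one_fderiv_le f hf2
      have htB : ENNReal.ofReal t * B = 2⁻¹ := by
        rw [ht, mul_inv, ENNReal.ofReal_mul (by positivity), ENNReal.ofReal_inv_of_pos two_pos,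
          ENNReal.ofReal_ofNat, ENNReal.ofReal_inv_of_pos hBpos, ENNReal.ofReal_toReal hBt,
          mul_assoc, ENNReal.inv_mul_cancel hB0 hBt, mul_one]
      have h4 : ENNReal.ofReal (2 / (t * ε)) = ENNReal.ofReal ε⁻¹ * (4 * B) := by
        rw [ht, show (2 : ℝ) / ((2 * B.toReal)⁻¹ * ε) = ε⁻¹ * (4 * B.toReal) by field_simp; ring,
          ENNReal.ofReal_mul (by positivity), ENNReal.ofReal_mul (by positivity), ENNReal.ofReal_ofNat,
          ENNReal.ofReal_toReal hBt]
      have hεinv : ENNReal.ofReal ε * ENNReal.ofReal ε⁻¹ = 1 := by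
        rw [← ENNReal.ofReal_mul hε.le, mul_inv_cancel₀ hε.ne', ENNReal.ofReal_one]
      -- `ε M₁ ≤ 4 B M₀ + 2⁻¹ ε P H + 2⁻¹ (ε M₁)`
      have h5 : ENNReal.ofReal ε * M₁ ≤
          (4 * B * M₀ + 2⁻¹ * (ENNReal.ofReal ε * P * H)) + 2⁻¹ * (ENNReal.ofReal ε * M₁) := by
        calc ENNReal.ofReal ε * M₁
            ≤ ENNReal.ofReal ε * (ENNReal.ofReal (2 / (t * ε)) * M₀ +
                ENNReal.ofReal ((t * ε) ^ ((1 : ℝ≥0) : ℝ)) * eHolderNorm 1 (fderiv ℝ f)) := by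
              gcongr
          _ ≤ ENNReal.ofReal ε * (ENNReal.ofReal (2 / (t * ε)) * M₀ +
                ENNReal.ofReal ((t * ε) ^ ((1 : ℝ≥0) : ℝ)) * M₂) := by gcongr
          _ = 4 * B * M₀ + ENNReal.ofReal t * (ENNReal.ofReal ε * (ENNReal.ofReal ε * M₂)) := by
              rw [NNReal.coe_one, Real.rpow_one, mul_add, ← mul_assoc, h4, ← mul_assoc, hεinv, one_mul,
                ENNReal.ofReal_mul htpos.le]
              ring
          _ ≤ 4 * B * M₀ + ENNReal.ofReal t * (ENNReal.ofReal ε * (B * (M₁ + P * H))) :=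
              add_le_add le_rfl (mul_le_mul' le_rfl (mul_le_mul' le_rfl (hM₂S.trans hIH)))
          _ = 4 * B * M₀ + (ENNReal.ofReal t * B) * (ENNReal.ofReal ε * P * H) +
                (ENNReal.ofReal t * B) * (ENNReal.ofReal ε * M₁) := by ring
          _ = _ := by rw [htB]
      have hkey : ENNReal.ofReal ε * M₁ ≤ 8 * B * M₀ + ENNReal.ofReal ε * P * H := by
        have hfin' : ENNReal.ofReal ε * M₁ ≠ ⊤ := ENNReal.mul_ne_top ENNReal.ofReal_ne_top hM₁fin
        calc ENNReal.ofReal ε * M₁ ≤ 2 * (4 * B * M₀ + 2⁻¹ * (ENNReal.ofReal ε * P * H)) :=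
              ennreal_le_two_mul_of_le_add_half hfin' h5
          _ = 8 * B * M₀ + ENNReal.ofReal ε * P * H := by
              rw [mul_add, ← mul_assoc 2 2⁻¹, ENNReal.mul_inv_cancel (by norm_num) (by norm_num), one_mul]
              ring
      -- assemble
      have hB2 : B ≤ B ^ 2 := by
        calc B = B * 1 := (mul_one B).symm
          _ ≤ B * B := mul_le_mul' le_rfl hB1
          _ = B ^ 2 := (sq B).symm
      have h1B : 1 ≤ B ^ 2 := hB1.trans hB2
      have hc1 : 1 + 8 * B ^ 2 ≤ 9 * B ^ 2 := by
        calc 1 + 8 * B ^ 2 ≤ B ^ 2 + 8 * B ^ 2 := add_le_add h1B le_rfl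
          _ = 9 * B ^ 2 := by ring
      have hc2 : 2 * B ≤ 9 * B ^ 2 :=
        calc 2 * B ≤ 2 * B ^ 2 := mul_le_mul' le_rfl hB2
          _ ≤ 9 * B ^ 2 := mul_le_mul' (by norm_num) le_rfl
      have hpow : (9 : ℝ≥0∞) ^ (2 ^ (k + 1 + 1) - 1) = 9 * B ^ 2 := by
        rw [hB, ← pow_mul, ← pow_succ']
        congr 1
        have h1 : 1 ≤ 2 ^ (k + 1) := Nat.one_le_two_pow
        have h2 : 2 ^ (k + 1 + 1) = 2 * 2 ^ (k + 1) := by rw [pow_succ']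
        omega
      rw [sum_eSupNorm_iteratedFDeriv_succ hε.le, hεpow, hpow]
      calc M₀ + ENNReal.ofReal ε * S ≤ M₀ + ENNReal.ofReal ε * (B * (M₁ + P * H)) := by gcongr
        _ = M₀ + B * (ENNReal.ofReal ε * M₁) + B * (ENNReal.ofReal ε * P * H) := by ring
        _ ≤ M₀ + B * (8 * B * M₀ + ENNReal.ofReal ε * P * H) + B * (ENNReal.ofReal ε * P * H) := by
            gcongr
        _ = (1 + 8 * B ^ 2) * M₀ + 2 * B * (ENNReal.ofReal ε * P * H) := by ring
        _ ≤ 9 * B ^ 2 * M₀ + 9 * B ^ 2 * (ENNReal.ofReal ε * P * H) :=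
            add_le_add (mul_le_mul' hc1 le_rfl) (mul_le_mul' hc2 le_rfl)
        _ = 9 * B ^ 2 * (M₀ + ENNReal.ofReal ε * P * H) := by rw [mul_add]

/-- `Dʲf` is Lipschitz with constant `‖Dʲ⁺¹f‖_∞` for a `C^{j+1}` map: `[Dʲf]_1 ≤ ‖Dʲ⁺¹f‖_∞`
(mean value inequality, `‖D(Dʲf)(x)‖ = ‖Dʲ⁺¹f(x)‖`). [folklore] -/
theorem eHolderNorm_one_iteratedFDeriv_le {Y : Type u} [NormedAddCommGroup Y] [NormedSpace ℝ Y]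
    {f : E' → Y} (j : ℕ) (hf : ContDiff ℝ (j + 1 : ℕ) f) :
    eHolderNorm 1 (iteratedFDeriv ℝ j f) ≤ eSupNorm (iteratedFDeriv ℝ (j + 1) f) := by
  by_cases hT : eSupNorm (iteratedFDeriv ℝ (j + 1) f) = ⊤
  · rw [hT]; exact le_top
  have hLip : LipschitzWith (eSupNorm (iteratedFDeriv ℝ (j + 1) f)).toNNReal (iteratedFDeriv ℝ j f) := by
    refine lipschitzWith_of_nnnorm_fderiv_le
      (hf.differentiable_iteratedFDeriv (by exact_mod_cast Nat.lt_succ_self j)) fun x => ?_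
    rw [← ENNReal.coe_le_coe, ENNReal.coe_toNNReal hT, ← enorm_eq_nnnorm, ← ofReal_norm,
      norm_fderiv_iteratedFDeriv, ofReal_norm]
    exact enorm_le_eSupNorm _ x
  refine (hLip.holderWith.eHolderNorm_le).trans ?_
  rw [ENNReal.coe_toNNReal hT]

/-- The oscillation of `Dʲf` is at most `2‖Dʲf‖_∞`. [folklore] -/
theorem edist_iteratedFDeriv_le_two_mul {Y : Type u} [NormedAddCommGroup Y] [NormedSpace ℝ Y]
    (f : E' → Y) (j : ℕ) (x y : E') :
    edist (iteratedFDeriv ℝ j f x) (iteratedFDeriv ℝ j f y) ≤ 2 * eSupNorm (iteratedFDeriv ℝ j f) := by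
  rw [edist_eq_enorm_sub, two_mul]
  exact (enorm_sub_le).trans (add_le_add (enorm_le_eSupNorm _ x) (enorm_le_eSupNorm _ y))

/-- **Interpolation inequality at scale `ε ≤ 1`, for the full `C^{j,r'}` norms** (BDSV App. A
(A.1), Gilbarg–Trudinger Lemma 6.35, whole-space form): for a `C^k` map with `‖f‖_{C^{k,r}} < ∞`,
an intermediate order `(j, r')` — `j < k` and `r' ≤ 1`, or `j = k` and `r' ≤ r` — and
`0 < ε ≤ 1`,
`‖f‖_{C^{j,r'}} ≤ 5·9^{2^k-1} ε^{-(j+r')} (‖f‖_∞ + ε^{k+r} [Dᵏf]_r)`.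
The sup norms come from `sum_eSupNorm_iteratedFDeriv_le`, the top seminorm `[Dʲf]_{r'}` by
interpolating at scale `ε` between the oscillation `2‖Dʲf‖_∞` and the Lipschitz bound `‖Dʲ⁺¹f‖_∞`
(`j < k`) or the `r`-Hölder bound `[Dᵏf]_r` (`j = k`). [folklore] -/
theorem eContDiffHolderNorm_le_interp_of_le_one {k j : ℕ} {Y : Type u} [NormedAddCommGroup Y]
    [NormedSpace ℝ Y] {f : E' → Y} (hf : ContDiff ℝ k f) {r r' : ℝ≥0}
    (hfin : eContDiffHolderNorm k r f ≠ ⊤) (hr' : r' ≤ 1) (hjk : j < k ∨ (j = k ∧ r' ≤ r)) {ε : ℝ}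
    (hε : 0 < ε) (hε1 : ε ≤ 1) :
    eContDiffHolderNorm j r' f ≤ 5 * 9 ^ (2 ^ k - 1) * ENNReal.ofReal (ε ^ (-((j : ℝ) + r'))) *
      (eSupNorm f + ENNReal.ofReal (ε ^ ((k : ℝ) + r)) * eHolderNorm r (iteratedFDeriv ℝ k f)) := by
  have hjk' : j ≤ k := by rcases hjk with h | ⟨h, -⟩ <;> omega
  set S : ℝ≥0∞ := ∑ i ∈ Finset.range (k + 1), ENNReal.ofReal (ε ^ i) * eSupNorm (iteratedFDeriv ℝ i f)
    with hS
  set P : ℝ≥0∞ := ENNReal.ofReal (ε ^ ((k : ℝ) + r)) * eHolderNorm r (iteratedFDeriv ℝ k f) with hP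
  set R : ℝ≥0∞ := eSupNorm f + P with hR
  set B : ℝ≥0∞ := 9 ^ (2 ^ k - 1) with hB
  have hSR : S ≤ B * R := sum_eSupNorm_iteratedFDeriv_le k hf hfin hε
  set w : ℝ≥0∞ := ENNReal.ofReal (ε ^ (-((j : ℝ) + r'))) with hw
  -- weights: `εⁱ M_i ≤ S` and `1 ≤ w εᵃ` for `a ≤ j + r'`
  have hterm : ∀ i ≤ k, ENNReal.ofReal (ε ^ i) * eSupNorm (iteratedFDeriv ℝ i f) ≤ S := fun i hi =>
    Finset.single_le_sum (f := fun i => ENNReal.ofReal (ε ^ i) * eSupNorm (iteratedFDeriv ℝ i f))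
      (fun _ _ => bot_le) (Finset.mem_range.2 (Nat.lt_succ_of_le hi))
  have hwpow : ∀ {a : ℝ}, a ≤ (j : ℝ) + r' → 1 ≤ w * ENNReal.ofReal (ε ^ a) := by
    intro a ha
    rw [hw, ← ENNReal.ofReal_mul (Real.rpow_nonneg hε.le _), ← Real.rpow_add hε, ← ENNReal.ofReal_one]
    exact ENNReal.ofReal_le_ofReal (Real.one_le_rpow_of_pos_of_le_one_of_nonpos hε hε1 (by linarith))
  have hwnat : ∀ i ≤ j, 1 ≤ w * ENNReal.ofReal (ε ^ i) := by
    intro i hij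
    have hcast : (i : ℝ) ≤ (j : ℝ) + r' := by
      have h1 : (i : ℝ) ≤ j := by exact_mod_cast hij
      linarith [r'.coe_nonneg]
    have := hwpow hcast
    rwa [Real.rpow_natCast] at this
  -- (a) the sup norms
  have hsup : ∑ i ∈ Finset.range (j + 1), eSupNorm (iteratedFDeriv ℝ i f) ≤ w * S := by
    have hle : ∀ i ∈ Finset.range (j + 1), eSupNorm (iteratedFDeriv ℝ i f) ≤
        w * (ENNReal.ofReal (ε ^ i) * eSupNorm (iteratedFDeriv ℝ i f)) := by
      intro i hi
      have hij : i ≤ j := by simpa [Finset.mem_range, Nat.lt_succ_iff] using hi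
      calc eSupNorm (iteratedFDeriv ℝ i f) = 1 * eSupNorm (iteratedFDeriv ℝ i f) := (one_mul _).symm
        _ ≤ (w * ENNReal.ofReal (ε ^ i)) * eSupNorm (iteratedFDeriv ℝ i f) :=
            mul_le_mul' (hwnat i hij) le_rfl
        _ = _ := mul_assoc _ _ _
    calc ∑ i ∈ Finset.range (j + 1), eSupNorm (iteratedFDeriv ℝ i f)
        ≤ ∑ i ∈ Finset.range (j + 1), w * (ENNReal.ofReal (ε ^ i) * eSupNorm (iteratedFDeriv ℝ i f)) :=
          Finset.sum_le_sum hle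
      _ = w * ∑ i ∈ Finset.range (j + 1), ENNReal.ofReal (ε ^ i) * eSupNorm (iteratedFDeriv ℝ i f) :=
          (Finset.mul_sum _ _ _).symm
      _ ≤ w * S := mul_le_mul' le_rfl
          (Finset.sum_le_sum_of_subset_of_nonneg (Finset.range_subset_range.2 (Nat.succ_le_succ hjk'))
            fun _ _ _ => bot_le)
  -- (b) the top Hölder seminorm
  have hosc := edist_iteratedFDeriv_le_two_mul f j
  set δ : ℝ≥0 := ⟨ε, hε.le⟩ with hδ
  have hε' : (0 : ℝ≥0) < δ := hε
  have hδε : (δ : ℝ) = ε := rfl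
  have hcoe1 : ∀ a : ℝ, (δ : ℝ≥0∞) ^ a = ENNReal.ofReal (ε ^ a) := fun a => by
    rw [← ENNReal.ofReal_coe_nnreal, hδε, ENNReal.ofReal_rpow_of_pos hε]
  have hcoe2 : (δ : ℝ≥0∞)⁻¹ ^ (r' : ℝ) = ENNReal.ofReal (ε ^ (-(r' : ℝ))) := by
    rw [← ENNReal.ofReal_coe_nnreal, hδε, ← ENNReal.ofReal_inv_of_pos hε,
      ENNReal.ofReal_rpow_of_pos (inv_pos.2 hε), Real.inv_rpow hε.le, ← Real.rpow_neg hε.le]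
  have e2 : ENNReal.ofReal (ε ^ (-(r' : ℝ))) = w * ENNReal.ofReal (ε ^ j) := by
    rw [hw, ← ENNReal.ofReal_mul (Real.rpow_nonneg hε.le _), ← Real.rpow_natCast, ← Real.rpow_add hε]
    congr 2; ring
  have hhol : eHolderNorm r' (iteratedFDeriv ℝ j f) ≤ w * (3 * S + P) := by
    rcases hjk with hlt | ⟨rfl, hrr⟩
    · -- `j < k`: Lipschitz bound `‖Dʲ⁺¹f‖_∞`
      have hfj : ContDiff ℝ (j + 1 : ℕ) f := hf.of_le (by exact_mod_cast hlt)
      have h2 := eHolderNorm_le_of_eHolderNorm_of_edist_le hosc hr' hε' (r := 1)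
      have hL := eHolderNorm_one_iteratedFDeriv_le j hfj
      have e1 : ENNReal.ofReal (ε ^ (((1 : ℝ≥0) : ℝ) - r')) = w * ENNReal.ofReal (ε ^ (j + 1)) := by
        rw [hw, ← ENNReal.ofReal_mul (Real.rpow_nonneg hε.le _), ← Real.rpow_natCast,
          ← Real.rpow_add hε]
        congr 2; push_cast; ring
      calc eHolderNorm r' (iteratedFDeriv ℝ j f)
          ≤ eHolderNorm 1 (iteratedFDeriv ℝ j f) * (δ : ℝ≥0∞) ^ (((1 : ℝ≥0) : ℝ) - r') +
              2 * eSupNorm (iteratedFDeriv ℝ j f) * (δ : ℝ≥0∞)⁻¹ ^ (r' : ℝ) := h2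
        _ ≤ eSupNorm (iteratedFDeriv ℝ (j + 1) f) * ENNReal.ofReal (ε ^ (((1 : ℝ≥0) : ℝ) - r')) +
              2 * eSupNorm (iteratedFDeriv ℝ j f) * ENNReal.ofReal (ε ^ (-(r' : ℝ))) := by
            rw [hcoe1, hcoe2]
            gcongr
        _ = w * (ENNReal.ofReal (ε ^ (j + 1)) * eSupNorm (iteratedFDeriv ℝ (j + 1) f)) +
              w * (2 * (ENNReal.ofReal (ε ^ j) * eSupNorm (iteratedFDeriv ℝ j f))) := by
            rw [e1, e2]; ring
        _ ≤ w * S + w * (2 * S) := by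
            gcongr
            · exact hterm (j + 1) hlt
            · exact hterm j hjk'
        _ = w * (3 * S) := by ring
        _ ≤ w * (3 * S + P) := by gcongr; exact le_self_add
    · -- `j = k`: the `r`-Hölder bound
      have h2 := eHolderNorm_le_of_eHolderNorm_of_edist_le hosc hrr hε' (r := r)
      have e1 : ENNReal.ofReal (ε ^ ((r : ℝ) - r')) = w * ENNReal.ofReal (ε ^ ((j : ℝ) + r)) := by
        rw [hw, ← ENNReal.ofReal_mul (Real.rpow_nonneg hε.le _), ← Real.rpow_add hε]
        congr 2; ring
      calc eHolderNorm r' (iteratedFDeriv ℝ j f)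
          ≤ eHolderNorm r (iteratedFDeriv ℝ j f) * (δ : ℝ≥0∞) ^ ((r : ℝ) - r') +
              2 * eSupNorm (iteratedFDeriv ℝ j f) * (δ : ℝ≥0∞)⁻¹ ^ (r' : ℝ) := h2
        _ = eHolderNorm r (iteratedFDeriv ℝ j f) * ENNReal.ofReal (ε ^ ((r : ℝ) - r')) +
              2 * eSupNorm (iteratedFDeriv ℝ j f) * ENNReal.ofReal (ε ^ (-(r' : ℝ))) := by
            rw [hcoe1, hcoe2]
        _ = w * P + w * (2 * (ENNReal.ofReal (ε ^ j) * eSupNorm (iteratedFDeriv ℝ j f))) := by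
            rw [e1, e2, hP]; ring
        _ ≤ w * P + w * (2 * S) := by
            gcongr
            exact hterm j le_rfl
        _ ≤ w * P + w * (3 * S) := by gcongr; norm_num
        _ = w * (3 * S + P) := by ring
  -- assemble
  have hB1 : 1 ≤ B := one_le_pow_of_one_le' (by norm_num) _
  unfold eContDiffHolderNorm
  calc (∑ i ∈ Finset.range (j + 1), eSupNorm (iteratedFDeriv ℝ i f)) + eHolderNorm r' (iteratedFDeriv ℝ j f)
      ≤ w * S + w * (3 * S + P) := add_le_add hsup hhol
    _ = w * (4 * S + P) := by ring
    _ ≤ w * (4 * (B * R) + R) := by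
        gcongr
        exact le_add_self
    _ = (4 * B + 1) * w * R := by ring
    _ ≤ 5 * B * w * R := by
        gcongr
        calc 4 * B + 1 ≤ 4 * B + B := add_le_add le_rfl hB1
          _ = 5 * B := by ring

end WeightedSum


/-! ## On the flat torus -/

namespace Torus

variable {d : Type u} [Fintype d] {Y Y' : Type u} [NormedAddCommGroup Y] [NormedSpace ℝ Y]
  [NormedAddCommGroup Y'] [NormedSpace ℝ Y']

/-- A function with vanishing sup norm vanishes, and so do all its `C^{j,r}` norms. [folklore] -/
theorem eContDiffHolderNorm_eq_zero_of_eSupNorm_eq_zero {f : UnitAddTorus d → Y}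
    (h : eSupNorm f = 0) (j : ℕ) (r : ℝ≥0) : Torus.eContDiffHolderNorm j r f = 0 := by
  have hf : f = 0 := by
    funext x
    have hx : ‖f x‖ₑ = 0 := le_antisymm (h ▸ enorm_le_eSupNorm f x) bot_le
    simpa using hx
  subst hf
  exact Torus.eContDiffHolderNorm_zero_fun j r

/-- **Interpolation inequality at scale `ε ≤ 1` on the torus** (BDSV App. A (A.1)): for a smooth
`f` on `T^d`, `r, r' ≤ 1`, an intermediate order (`j < k`, or `j = k` and `r' ≤ r`) and
`0 < ε ≤ 1`, `‖f‖_{C^{j,r'}} ≤ 5·9^{2^k-1} ε^{-(j+r')} (‖f‖_∞ + ε^{k+r} ‖f‖_{C^{k,r}})`. [folklore] -/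
theorem eContDiffHolderNorm_le_interp_of_le_one {f : UnitAddTorus d → Y} (hf : IsSmooth f)
    {k j : ℕ} {r r' : ℝ≥0} (hr : r ≤ 1) (hr' : r' ≤ 1) (hjk : j < k ∨ (j = k ∧ r' ≤ r)) {ε : ℝ}
    (hε : 0 < ε) (hε1 : ε ≤ 1) :
    Torus.eContDiffHolderNorm j r' f ≤ 5 * 9 ^ (2 ^ k - 1) * ENNReal.ofReal (ε ^ (-((j : ℝ) + r'))) *
      (eSupNorm f + ENNReal.ofReal (ε ^ ((k : ℝ) + r)) * Torus.eContDiffHolderNorm k r f) := by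
  have hfin : FunctionSpaces.eContDiffHolderNorm k r (lift f) ≠ ⊤ := (hf.eContDiffHolderNorm_lt_top k hr).ne
  have h := FunctionSpaces.eContDiffHolderNorm_le_interp_of_le_one (hf.isContDiff (n := k) (by exact_mod_cast le_top))
    hfin hr' hjk hε hε1
  rw [eSupNorm_lift] at h
  refine h.trans (mul_le_mul' le_rfl (add_le_add le_rfl (mul_le_mul' le_rfl ?_)))
  exact FunctionSpaces.eHolderNorm_iteratedFDeriv_le_eContDiffHolderNorm k r (lift f)

/-- **Comparison of intermediate and extreme norms** (the case `ε = 1`): for smooth `f` on `T^d`,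
`‖f‖_{C^{j,r'}} ≤ 5·9^{2^k-1} (‖f‖_∞ + ‖f‖_{C^{k,r}})` whenever `j < k`, or `j = k` and `r' ≤ r`
(`r, r' ≤ 1`). [folklore] -/
theorem eContDiffHolderNorm_le_eSupNorm_add {f : UnitAddTorus d → Y} (hf : IsSmooth f)
    {k j : ℕ} {r r' : ℝ≥0} (hr : r ≤ 1) (hr' : r' ≤ 1) (hjk : j < k ∨ (j = k ∧ r' ≤ r)) :
    Torus.eContDiffHolderNorm j r' f ≤ 5 * 9 ^ (2 ^ k - 1) * (eSupNorm f + Torus.eContDiffHolderNorm k r f) := by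
  have h := eContDiffHolderNorm_le_interp_of_le_one hf hr hr' hjk one_pos le_rfl
  rw [Real.one_rpow, Real.one_rpow, ENNReal.ofReal_one, mul_one, one_mul] at h
  exact h

/-- **The tame product inequality** (the use of BDSV App. A (A.1)/(A.3) for products): for smooth
`f, g` on `T^d`, orders `(j₁, r₁)`, `(j₂, r₂)` with `j₁, j₂ ≤ k`, `r₁, r₂, r ≤ 1` and total order
`(j₁ + r₁) + (j₂ + r₂) ≤ k + r`,
`‖f‖_{j₁,r₁} ‖g‖_{j₂,r₂} ≤ 2 (5·9^{2^k-1})² (‖f‖_∞ ‖g‖_{k,r} + ‖f‖_{k,r} ‖g‖_∞)`.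
Proof: both factors are interpolated at the same scale `ε = (‖f‖_∞/‖f‖_{k,r})^{1/(k+r)} ≤ 1`, for
which `ε^{k+r}‖f‖_{k,r} = ‖f‖_∞` and `ε^{-(j₁+r₁+j₂+r₂)} ‖f‖_∞ ≤ ‖f‖_{k,r}`. [folklore] -/
theorem eContDiffHolderNorm_mul_le_mixed_tame {f : UnitAddTorus d → Y} {g : UnitAddTorus d → Y'}
    (hf : IsSmooth f) (hg : IsSmooth g) {k j₁ j₂ : ℕ} {r r₁ r₂ : ℝ≥0} (hr : r ≤ 1) (hr₁ : r₁ ≤ 1)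
    (hr₂ : r₂ ≤ 1) (hj₁ : j₁ ≤ k) (hj₂ : j₂ ≤ k)
    (hsum : (j₁ : ℝ) + r₁ + (j₂ + r₂) ≤ k + r) :
    Torus.eContDiffHolderNorm j₁ r₁ f * Torus.eContDiffHolderNorm j₂ r₂ g ≤
      2 * (5 * 9 ^ (2 ^ k - 1)) ^ 2 * (eSupNorm f * Torus.eContDiffHolderNorm k r g +
        Torus.eContDiffHolderNorm k r f * eSupNorm g) := by
  set B : ℝ≥0∞ := 9 ^ (2 ^ k - 1) with hB
  set X₀ := eSupNorm f with hX₀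
  set X := Torus.eContDiffHolderNorm k r f with hX
  set Y₀ := eSupNorm g with hY₀
  set YY := Torus.eContDiffHolderNorm k r g with hYY
  have hB1 : 1 ≤ B := one_le_pow_of_one_le' (by norm_num) _
  have hB5 : 1 ≤ 5 * B := hB1.trans (le_mul_of_one_le_left' (by norm_num))
  have hC1 : 1 ≤ 2 * (5 * B) ^ 2 := by
    calc (1 : ℝ≥0∞) = 1 * 1 ^ 2 := by norm_num
      _ ≤ 2 * (5 * B) ^ 2 := by gcongr; norm_num
  -- admissibility of the two orders
  have hadm₁ : j₁ < k ∨ (j₁ = k ∧ r₁ ≤ r) := by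
    rcases Nat.lt_or_eq_of_le hj₁ with h | h
    · exact Or.inl h
    · refine Or.inr ⟨h, ?_⟩
      subst h
      have : (r₁ : ℝ) ≤ r := by linarith [r₂.coe_nonneg, (Nat.cast_nonneg j₂ : (0:ℝ) ≤ j₂)]
      exact_mod_cast this
  have hadm₂ : j₂ < k ∨ (j₂ = k ∧ r₂ ≤ r) := by
    rcases Nat.lt_or_eq_of_le hj₂ with h | h
    · exact Or.inl h
    · refine Or.inr ⟨h, ?_⟩
      subst h
      have : (r₂ : ℝ) ≤ r := by linarith [r₁.coe_nonneg, (Nat.cast_nonneg j₁ : (0:ℝ) ≤ j₁)]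
      exact_mod_cast this
  -- finiteness and the easy comparisons
  have hXt : X ≠ ⊤ := (hf.eContDiffHolderNorm_lt_top k hr).ne
  have hX₀X : X₀ ≤ X := Torus.eSupNorm_le_eContDiffHolderNorm k r f
  have hY₀Y : Y₀ ≤ YY := Torus.eSupNorm_le_eContDiffHolderNorm k r g
  -- degenerate cases
  by_cases hX0 : X₀ = 0
  · rw [eContDiffHolderNorm_eq_zero_of_eSupNorm_eq_zero hX0, zero_mul]; exact bot_le
  by_cases hY0 : Y₀ = 0
  · rw [eContDiffHolderNorm_eq_zero_of_eSupNorm_eq_zero hY0, mul_zero]; exact bot_le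
  set K : ℝ := (k : ℝ) + r with hK
  have hK0 : 0 ≤ K := by positivity
  rcases hK0.eq_or_lt with hK00 | hKpos
  · -- `k = 0`, `r = 0`: everything is of order zero
    have hk : k = 0 := by
      rcases Nat.eq_zero_or_pos k with h | h
      · exact h
      · exfalso
        have : (1 : ℝ) ≤ k := by exact_mod_cast h
        linarith [r.coe_nonneg]
    have hj₁0 : j₁ = 0 := by omega
    have hj₂0 : j₂ = 0 := by omega
    have hr₁0 : r₁ = 0 := by
      have : (r₁ : ℝ) ≤ 0 := by
        subst hk; linarith [r₂.coe_nonneg, (Nat.cast_nonneg j₂ : (0:ℝ) ≤ j₂), (Nat.cast_nonneg j₁ : (0:ℝ) ≤ j₁)]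
      exact le_antisymm (by exact_mod_cast this) bot_le
    subst hj₁0 hj₂0 hr₁0
    -- `‖f‖_{0,0} ≤ 3 ‖f‖_∞`
    have h3 : Torus.eContDiffHolderNorm 0 0 f ≤ 3 * X₀ := by
      rw [Torus.eContDiffHolderNorm, eContDiffHolderNorm_zero_eq, eSupNorm_lift]
      calc eSupNorm f + eHolderNorm 0 (lift f) ≤ eSupNorm f + 2 * eSupNorm (lift f) :=
            add_le_add le_rfl (eHolderNorm_zero_le_two_mul_eSupNorm _)
        _ = 3 * X₀ := by rw [eSupNorm_lift]; ring
    have h4 : Torus.eContDiffHolderNorm 0 r₂ g ≤ 5 * B * (Y₀ + YY) :=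
      eContDiffHolderNorm_le_eSupNorm_add hg hr hr₂ hadm₂
    calc Torus.eContDiffHolderNorm 0 0 f * Torus.eContDiffHolderNorm 0 r₂ g
        ≤ (3 * X₀) * (5 * B * (Y₀ + YY)) := mul_le_mul' h3 h4
      _ ≤ (3 * X₀) * (5 * B * (YY + YY)) := by gcongr
      _ = (30 * B) * (X₀ * YY) := by ring
      _ ≤ (2 * (5 * B) ^ 2) * (X₀ * YY + X * Y₀) := by
          refine mul_le_mul' ?_ le_self_add
          calc 30 * B = 30 * B * 1 := (mul_one _).symm
            _ ≤ 50 * B * B := by gcongr; norm_num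
            _ = 2 * (5 * B) ^ 2 := by ring
  -- main case: interpolate both factors at the scale `ε = (X₀/X)^{1/K}`
  have hX0' : X ≠ 0 := fun h => hX0 (le_antisymm (h ▸ hX₀X) bot_le)
  set x₀ : ℝ := X₀.toReal with hx₀
  set x : ℝ := X.toReal with hx
  have hX₀t : X₀ ≠ ⊤ := ne_top_of_le_ne_top hXt hX₀X
  have hx₀pos : 0 < x₀ := ENNReal.toReal_pos hX0 hX₀t
  have hxpos : 0 < x := ENNReal.toReal_pos hX0' hXt
  have hx₀x : x₀ ≤ x := ENNReal.toReal_mono hXt hX₀X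
  set u : ℝ := x₀ / x with hu
  have hu0 : 0 < u := div_pos hx₀pos hxpos
  have hu1 : u ≤ 1 := (div_le_one hxpos).2 hx₀x
  set ε : ℝ := u ^ (1 / K) with hε
  have hε0 : 0 < ε := Real.rpow_pos_of_pos hu0 _
  have hε1 : ε ≤ 1 := Real.rpow_le_one hu0.le hu1 (by positivity)
  have hεK : ε ^ K = u := by
    rw [hε, ← Real.rpow_mul hu0.le, one_div_mul_cancel hKpos.ne', Real.rpow_one]
  -- `ε^K X = X₀` and `ε^{-s} X₀ ≤ X` for `s ≤ K`
  have hXeq : ENNReal.ofReal (ε ^ K) * X = X₀ := by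
    rw [hεK, ← ENNReal.ofReal_toReal hXt, ← ENNReal.ofReal_mul hu0.le, ← hx, hu,
      div_mul_cancel₀ _ hxpos.ne', hx₀, ENNReal.ofReal_toReal hX₀t]
  have hXle : ∀ {s : ℝ}, 0 ≤ s → s ≤ K → ENNReal.ofReal (ε ^ (-s)) * X₀ ≤ X := by
    intro s hs0 hsK
    have h1 : ε ^ (-s) ≤ u⁻¹ := by
      rw [hε, ← Real.rpow_mul hu0.le, ← Real.rpow_neg_one]
      refine Real.rpow_le_rpow_of_exponent_ge hu0 hu1 ?_
      rw [one_div_mul_eq_div, neg_div, neg_le_neg_iff, div_le_one hKpos]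
      exact hsK
    calc ENNReal.ofReal (ε ^ (-s)) * X₀ ≤ ENNReal.ofReal u⁻¹ * X₀ := by gcongr
      _ = X := by
          rw [← ENNReal.ofReal_toReal hX₀t, ← ENNReal.ofReal_mul (inv_pos.2 hu0).le, ← hx₀, hu,
            inv_div, div_mul_cancel₀ _ hx₀pos.ne', hx, ENNReal.ofReal_toReal hXt]
  -- the two interpolation bounds
  have h₁ := eContDiffHolderNorm_le_interp_of_le_one hf hr hr₁ hadm₁ hε0 hε1
  have h₂ := eContDiffHolderNorm_le_interp_of_le_one hg hr hr₂ hadm₂ hε0 hε1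
  rw [← hX₀, ← hX, ← hK] at h₁
  rw [← hY₀, ← hYY, ← hK] at h₂
  have h₁' : Torus.eContDiffHolderNorm j₁ r₁ f ≤ (5 * B) * ENNReal.ofReal (ε ^ (-((j₁ : ℝ) + r₁))) * (2 * X₀) := by
    refine h₁.trans (mul_le_mul' le_rfl ?_)
    rw [hXeq, two_mul]
  -- the product
  have hs0 : 0 ≤ (j₁ : ℝ) + r₁ + ((j₂ : ℝ) + r₂) := by positivity
  have hpow1 : ENNReal.ofReal (ε ^ (-((j₁ : ℝ) + r₁))) * ENNReal.ofReal (ε ^ (-((j₂ : ℝ) + r₂))) =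
      ENNReal.ofReal (ε ^ (-((j₁ : ℝ) + r₁ + ((j₂ : ℝ) + r₂)))) := by
    rw [← ENNReal.ofReal_mul (Real.rpow_nonneg hε0.le _), ← Real.rpow_add hε0]
    congr 2; ring
  have hpow2 : ENNReal.ofReal (ε ^ (-((j₁ : ℝ) + r₁ + ((j₂ : ℝ) + r₂)))) * ENNReal.ofReal (ε ^ K) ≤ 1 := by
    rw [← ENNReal.ofReal_mul (Real.rpow_nonneg hε0.le _), ← Real.rpow_add hε0, ← ENNReal.ofReal_one]
    exact ENNReal.ofReal_le_ofReal (Real.rpow_le_one hε0.le hε1 (by linarith))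
  calc Torus.eContDiffHolderNorm j₁ r₁ f * Torus.eContDiffHolderNorm j₂ r₂ g
      ≤ ((5 * B) * ENNReal.ofReal (ε ^ (-((j₁ : ℝ) + r₁))) * (2 * X₀)) *
          ((5 * B) * ENNReal.ofReal (ε ^ (-((j₂ : ℝ) + r₂))) * (Y₀ + ENNReal.ofReal (ε ^ K) * YY)) :=
        mul_le_mul' h₁' h₂
    _ = 2 * (5 * B) ^ 2 * ((ENNReal.ofReal (ε ^ (-((j₁ : ℝ) + r₁))) * ENNReal.ofReal (ε ^ (-((j₂ : ℝ) + r₂)))) *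
          X₀ * Y₀ + (ENNReal.ofReal (ε ^ (-((j₁ : ℝ) + r₁))) * ENNReal.ofReal (ε ^ (-((j₂ : ℝ) + r₂))) *
          ENNReal.ofReal (ε ^ K)) * (X₀ * YY)) := by ring
    _ ≤ 2 * (5 * B) ^ 2 * (X * Y₀ + 1 * (X₀ * YY)) := by
        rw [hpow1]
        gcongr
        · exact hXle hs0 hsum
    _ = 2 * (5 * B) ^ 2 * (X₀ * YY + X * Y₀) := by ring

end Torus

end Literature.Analysis.FunctionSpaces
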